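import Mathlib
import Literature.Analysis.FluidPDE.HardSphereCollisionRecord
import Literature.MathematicalPhysics.KineticTheory.HardSphereEuler
import Literature.MathematicalPhysics.KineticTheory.HardSphereEulerProofs
import Summits.AtomisticToContinuum.HydrodynamicLimit.Theorems.BoltzmannGreenKubo.Negative.Stationarity
import Summits.AtomisticToContinuum.HydrodynamicLimit.Theorems.BoltzmannGreenKubo.Negative.JointMeasurability
import Summits.AtomisticToContinuum.HydrodynamicLimit.Theorems.OneFlightGossipEngineEnergyCurrentTailsDocking
import Summits.AtomisticToContinuum.HydrodynamicLimit.Theorems.OneFlightGossipEngineOneFlightLayeredChaosFluxRegimes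
import Summits.AtomisticToContinuum.HydrodynamicLimit.Theorems.AntiMazurCoboundariesPressureCertificateTransfer
import HarnessLib

/-!
# `OneFlightGossipEngine.OneFlightLayeredChaos` — no wrap-around inside the kinetic window
(crux stmt-AtomisticToContinuum-14535, line `Sketch`, lead cycle c3; registered stub `stub_noWrap`)

Under the global Gibbs law `P = localGibbsLaw σ 1 0 θ₀ N Φ` of `N + 1` hard spheres of diameter
`ε_N = σ (N+1)^{-1/3}` on the unit torus with Maxwellian `N(0, θ₀ I)` velocities, inside the kinetic window
`(0, w]`, `w = τ (N+1)^{-1/3}`, NO particle has (`lintegral`) path length `≥ 1/4`, with `P`-probability `≥ 1 − δ`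
for `N ≥ N₀(θ₀, τ, δ)`:

`P {z | ∃ k, 1/4 ≤ ∫⁻_{(0,w]} ‖v_k(Φ_t z)‖ dt} ≤ δ`.

Proof (`stub_noWrap`): union bound over `k`; for one particle, with `V = 1/(8w)`, the pointwise split
`‖v‖ ≤ V + ‖v‖ 𝟙{V ≤ ‖v‖}` shows that `1/4 ≤ ∫⁻ ‖v_k‖` forces `1/8 ≤ F(z) := ∫⁻_{(0,w]} ‖v_k‖ 𝟙{V ≤ ‖v_k‖} ∘ Φ_t`;
Markov (`meas_ge_le_lintegral_div`; `F` is a.e.-measurable by the joint a.e.-measurability of the flow,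
`BoltzmannGreenKuboOrthMomentum.aemeasurable_uncurry_flow`); Tonelli + stationarity of `P`
(`AntiMazurCertificate.lintegral_setLIntegral_comp_flow` with
`BoltzmannGreenKuboOrthMomentum.measurePreserving_flow_localGibbsLaw`, `OLC.localGibbsLaw_one_compl_good`) give
`∫⁻ F dP = w ∫⁻ ‖v_k‖ 𝟙{V ≤ ‖v_k‖} dP`;
the one-body velocity marginal is `N(0, θ₀ I)` (`LoschmidtTagging.lintegral_vel_localGibbsLaw_const`) and
`∫ ‖v‖ 𝟙{V ≤ ‖v‖} dN(0,θ₀) ≤ V⁻³ ∫ ‖v‖⁴ dN(0,θ₀) =: V⁻³ M₄` (Fernique); total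
`(N+1) · 8 w · (8w)³ M₄ = 8⁴ M₄ τ⁴ (N+1)^{-1/3} → 0`.

References: C. Cercignani, R. Illner, M. Pulvirenti, *The Mathematical Theory of Dilute Gases* (1994) §4.2
(Maxwellian velocity tails under the equilibrium measure); H. Spohn, *Large Scale Dynamics of Interacting
Particles* (1991) Part I §2.3.
-/

open scoped BigOperators ENNReal
open MeasureTheory ProbabilityTheory Set Filter Topology
open Literature.Analysis.FluidPDE Literature.MathematicalPhysics.KineticTheory

namespace Summit.AtomisticToContinuum.HydrodynamicLimit.Theorems

noncomputable section

namespace NoWrap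

/-! ## One-body ingredients -/

/-- The truncated speed `‖v‖ 𝟙{V ≤ ‖v‖}` (an `ℝ≥0∞`-valued one-body observable, written throughout as
`{v | V ≤ ‖v‖}.indicator (fun v => ENNReal.ofReal ‖v‖)`) is measurable. [folklore] -/
theorem measurable_speedTail (V : ℝ) :
    Measurable ({v : V3 | V ≤ ‖v‖}.indicator fun v => ENNReal.ofReal ‖v‖) :=
  (measurable_norm.ennreal_ofReal).indicator (measurableSet_le measurable_const measurable_norm)

/-- Pointwise split of the speed at level `V`: `‖v‖ ≤ V + ‖v‖ 𝟙{V ≤ ‖v‖}`. [folklore] -/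
theorem ofReal_norm_le_add_speedTail (V : ℝ) (v : V3) :
    ENNReal.ofReal ‖v‖ ≤ ENNReal.ofReal V + {v : V3 | V ≤ ‖v‖}.indicator (fun v => ENNReal.ofReal ‖v‖) v := by
  by_cases h : V ≤ ‖v‖
  · rw [Set.indicator_of_mem (show v ∈ {v : V3 | V ≤ ‖v‖} from h)]
    exact le_add_self
  · rw [Set.indicator_of_notMem (show v ∉ {v : V3 | V ≤ ‖v‖} from h), add_zero]
    exact ENNReal.ofReal_le_ofReal (not_le.1 h).le

/-- Fourth-moment domination of the truncated speed: `‖v‖ 𝟙{V ≤ ‖v‖} ≤ ‖v‖⁴ / V³` for `V > 0`. [folklore] -/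
theorem speedTail_le_pow_four {V : ℝ} (hV : 0 < V) (v : V3) :
    {v : V3 | V ≤ ‖v‖}.indicator (fun v => ENNReal.ofReal ‖v‖) v ≤ ENNReal.ofReal (‖v‖ ^ 4 / V ^ 3) := by
  by_cases h : V ≤ ‖v‖
  · rw [Set.indicator_of_mem (show v ∈ {v : V3 | V ≤ ‖v‖} from h)]
    refine ENNReal.ofReal_le_ofReal ?_
    rw [le_div_iff₀ (pow_pos hV 3)]
    have h3 : V ^ 3 ≤ ‖v‖ ^ 3 := pow_le_pow_left₀ hV.le h 3
    nlinarith [norm_nonneg v]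
  · rw [Set.indicator_of_notMem (show v ∉ {v : V3 | V ≤ ‖v‖} from h)]
    exact bot_le

/-- **Maxwellian tail of the truncated speed**: `∫ ‖v‖ 𝟙{V ≤ ‖v‖} dN(0, θ I₃) ≤ V⁻³ ∫ ‖v‖⁴ dN(0, θ I₃)`
(the quartic moment is finite by Fernique's theorem). [folklore] -/
theorem lintegral_speedTail_gauss_le (θ : ℝ) {V : ℝ} (hV : 0 < V) :
    ∫⁻ v, {v : V3 | V ≤ ‖v‖}.indicator (fun v => ENNReal.ofReal ‖v‖) v ∂(gaussMeasure (0 : V3) θ) ≤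
      ENNReal.ofReal ((∫ v, ‖v‖ ^ 4 ∂(gaussMeasure (0 : V3) θ)) / V ^ 3) := by
  have h4 : Integrable (fun v : V3 => ‖v‖ ^ 4) (gaussMeasure (0 : V3) θ) :=
    (IsGaussian.memLp_id _ 4 (by simp)).integrable_norm_pow (by norm_num)
  calc ∫⁻ v, {v : V3 | V ≤ ‖v‖}.indicator (fun v => ENNReal.ofReal ‖v‖) v ∂(gaussMeasure (0 : V3) θ)
      ≤ ∫⁻ v, ENNReal.ofReal (‖v‖ ^ 4 / V ^ 3) ∂(gaussMeasure (0 : V3) θ) :=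
        lintegral_mono fun v => speedTail_le_pow_four hV v
    _ = ENNReal.ofReal (∫ v, ‖v‖ ^ 4 / V ^ 3 ∂(gaussMeasure (0 : V3) θ)) := by
        rw [ofReal_integral_eq_lintegral_ofReal (h4.div_const _)
          (Eventually.of_forall fun v => by positivity)]
    _ = ENNReal.ofReal ((∫ v, ‖v‖ ^ 4 ∂(gaussMeasure (0 : V3) θ)) / V ^ 3) := by
        rw [integral_div]

/-! ## The global Gibbs law along the flow -/

/-- The window functional `z ↦ ∫⁻_{(a,b]} G (Φ_s z) ds` of a measurable `G ≥ 0` is a.e.-measurable under the global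
Gibbs law `P` (joint a.e.-measurability of the flow on `Leb|_{(a,b]} ⊗ P`,
`BoltzmannGreenKuboOrthMomentum.aemeasurable_uncurry_flow`, since `P(goodᶜ) = 0`). [folklore] -/
theorem aemeasurable_setLIntegral_comp_flow {θ₀ : ℝ} (hθ : 0 < θ₀) {σ : ℝ} (hσ2 : σ ≤ 2⁻¹) (N : ℕ)
    (Φ : HardSphereFlow (Torus.geometry (Fin 3)) (hsDiameter σ N) (N + 1))
    {G : Config (N + 1) (Fin 3) T3 → ℝ≥0∞} (hG : Measurable G) (a b : ℝ) :
    AEMeasurable (fun z => ∫⁻ s in Ioc a b, G (Φ.flow s z))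
      (localGibbsLaw σ (fun _ => 1) (fun _ => 0) (fun _ => θ₀) N Φ) := by
  haveI : IsProbabilityMeasure (localGibbsLaw σ (fun _ => 1) (fun _ => 0) (fun _ => θ₀) N Φ) :=
    isProbabilityMeasure_localGibbsLaw continuous_const continuous_const continuous_const
      (fun _ => one_pos) (fun _ => hθ) (by linarith) N Φ
  exact (hG.comp_aemeasurable (BoltzmannGreenKuboOrthMomentum.aemeasurable_uncurry_flow Φ
    (volume.restrict (Ioc a b)) _ (OLC.localGibbsLaw_one_compl_good σ θ₀ N Φ))).lintegral_prod_left'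

/-! ## One particle: truncation, Markov, stationarity, marginal -/

/-- **Long path of one particle is unlikely.** For `w > 0` and every particle `k`,
`P {z | 1/4 ≤ ∫⁻_{(0,w]} ‖v_k(Φ_t z)‖ dt} ≤ 8⁴ M₄ w⁴`, `M₄ = ∫ ‖v‖⁴ dN(0, θ₀ I₃)`: split the speed at
`V = 1/(8w)` (the slow part integrates to `≤ 1/8`), Markov at level `1/8` for the window integral of the truncated
speed, Tonelli + stationarity, Maxwellian one-body marginal, quartic-moment tail bound. [folklore] -/
theorem measure_longPath_particle_le {θ₀ : ℝ} (hθ : 0 < θ₀) {σ : ℝ} (hσ2 : σ ≤ 2⁻¹) (N : ℕ)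
    (Φ : HardSphereFlow (Torus.geometry (Fin 3)) (hsDiameter σ N) (N + 1)) (k : Fin (N + 1))
    {w : ℝ} (hw : 0 < w) :
    localGibbsLaw σ (fun _ => 1) (fun _ => 0) (fun _ => θ₀) N Φ
        {z | ENNReal.ofReal (1 / 4) ≤ ∫⁻ t in Ioc 0 w, ENNReal.ofReal ‖(Φ.flow t z k).2‖} ≤
      ENNReal.ofReal (8 ^ 4 * (∫ v, ‖v‖ ^ 4 ∂(gaussMeasure (0 : V3) θ₀)) * w ^ 4) := by
  set P := localGibbsLaw σ (fun _ => 1) (fun _ => 0) (fun _ => θ₀) N Φ with hP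
  set M : ℝ := ∫ v, ‖v‖ ^ 4 ∂(gaussMeasure (0 : V3) θ₀) with hM
  haveI : IsProbabilityMeasure P :=
    isProbabilityMeasure_localGibbsLaw continuous_const continuous_const continuous_const
      (fun _ => one_pos) (fun _ => hθ) (by linarith) N Φ
  have hσ' : σ ≤ 1 / 2 := by linarith
  -- the truncation level
  set V : ℝ := (8 * w)⁻¹ with hV
  have hV0 : 0 < V := by positivity
  have hVw : V * w = 1 / 8 := by
    rw [hV]
    field_simp
  -- the truncated speed, the one-body observable and its window functional
  set H : V3 → ℝ≥0∞ := {v : V3 | V ≤ ‖v‖}.indicator fun v => ENNReal.ofReal ‖v‖ with hHdef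
  have hH : Measurable H := measurable_speedTail V
  set G : Config (N + 1) (Fin 3) T3 → ℝ≥0∞ := fun y => H ((y k).2) with hGdef
  have hG : Measurable G := hH.comp (measurable_pi_apply k).snd
  set F : Config (N + 1) (Fin 3) T3 → ℝ≥0∞ := fun z => ∫⁻ t in Ioc 0 w, G (Φ.flow t z) with hFdef
  have hF : AEMeasurable F P := aemeasurable_setLIntegral_comp_flow hθ hσ2 N Φ hG 0 w
  -- (2) truncation: a long path forces a large window integral of the truncated speed
  have hsub : {z | ENNReal.ofReal (1 / 4) ≤ ∫⁻ t in Ioc 0 w, ENNReal.ofReal ‖(Φ.flow t z k).2‖} ⊆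
      {z | ENNReal.ofReal (1 / 8) ≤ F z} := by
    intro z hz
    simp only [Set.mem_setOf_eq] at hz ⊢
    by_contra hlt
    rw [not_le] at hlt
    have hle : ∫⁻ t in Ioc 0 w, ENNReal.ofReal ‖(Φ.flow t z k).2‖ ≤ ENNReal.ofReal (1 / 8) + F z := by
      calc ∫⁻ t in Ioc 0 w, ENNReal.ofReal ‖(Φ.flow t z k).2‖
          ≤ ∫⁻ t in Ioc 0 w, (ENNReal.ofReal V + G (Φ.flow t z)) :=
            lintegral_mono fun t => ofReal_norm_le_add_speedTail V _
        _ = ENNReal.ofReal V * volume (Ioc (0 : ℝ) w) + F z := by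
            rw [lintegral_add_left measurable_const, setLIntegral_const]
        _ = ENNReal.ofReal (1 / 8) + F z := by
            rw [Real.volume_Ioc, sub_zero, ← ENNReal.ofReal_mul hV0.le, hVw]
    have hlt2 : ENNReal.ofReal (1 / 8) + F z < ENNReal.ofReal (1 / 8) + ENNReal.ofReal (1 / 8) :=
      ENNReal.add_lt_add_left ENNReal.ofReal_ne_top hlt
    have h14 : ENNReal.ofReal (1 / 8) + ENNReal.ofReal (1 / 8) = ENNReal.ofReal (1 / 4) := by
      rw [← ENNReal.ofReal_add (by norm_num) (by norm_num)]
      norm_num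
    rw [h14] at hlt2
    exact absurd (hz.trans hle) (not_le.2 hlt2)
  -- (4)+(5) Tonelli and stationarity, (6) Maxwellian marginal
  have hFint : ∫⁻ z, F z ∂P = ENNReal.ofReal w * ∫⁻ v, H v ∂(gaussMeasure (0 : V3) θ₀) := by
    have h45 : ∫⁻ z, F z ∂P = volume (Ioc (0 : ℝ) w) * ∫⁻ z, G z ∂P :=
      AntiMazurCertificate.lintegral_setLIntegral_comp_flow Φ P
        (fun t => BoltzmannGreenKuboOrthMomentum.measurePreserving_flow_localGibbsLaw 1 θ₀ 0 Φ t)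
        (OLC.localGibbsLaw_one_compl_good σ θ₀ N Φ) hG 0 w
    have h6 : ∫⁻ z, G z ∂P = ∫⁻ v, H v ∂(gaussMeasure (0 : V3) θ₀) :=
      LoschmidtTagging.lintegral_vel_localGibbsLaw_const (H := H) hσ' one_pos hθ N Φ k hH
    rw [h45, h6, Real.volume_Ioc, sub_zero]
  -- (3) Markov and assembly
  have h18 : ENNReal.ofReal (1 / 8) ≠ 0 := (ENNReal.ofReal_pos.2 (by norm_num)).ne'
  calc P {z | ENNReal.ofReal (1 / 4) ≤ ∫⁻ t in Ioc 0 w, ENNReal.ofReal ‖(Φ.flow t z k).2‖}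
      ≤ P {z | ENNReal.ofReal (1 / 8) ≤ F z} := measure_mono hsub
    _ ≤ (∫⁻ z, F z ∂P) / ENNReal.ofReal (1 / 8) := meas_ge_le_lintegral_div hF h18 ENNReal.ofReal_ne_top
    _ = (ENNReal.ofReal w * ∫⁻ v, H v ∂(gaussMeasure (0 : V3) θ₀)) / ENNReal.ofReal (1 / 8) := by
        rw [hFint]
    _ ≤ (ENNReal.ofReal w * ENNReal.ofReal (M / V ^ 3)) / ENNReal.ofReal (1 / 8) := by
        gcongr
        exact lintegral_speedTail_gauss_le θ₀ hV0
    _ = ENNReal.ofReal (w * (M / V ^ 3) / (1 / 8)) := by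
        rw [← ENNReal.ofReal_mul hw.le]
        exact (ENNReal.ofReal_div_of_pos (by norm_num : (0 : ℝ) < 1 / 8)).symm
    _ = ENNReal.ofReal (8 ^ 4 * M * w ^ 4) := by
        congr 1
        rw [hV, inv_pow, div_inv_eq_mul]
        ring

/-! ## The scale bookkeeping and the stub -/

/-- `C (N+1)^{-1/3} ≤ δ` for all large `N`. [folklore] -/
theorem exists_nat_mul_rpow_le (C : ℝ) {δ : ℝ} (hδ : 0 < δ) :
    ∃ N₀ : ℕ, ∀ N : ℕ, N₀ ≤ N → C * ((N + 1 : ℕ) : ℝ) ^ (-(1 / 3 : ℝ)) ≤ δ := by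
  have h1 : Tendsto (fun N : ℕ => ((N + 1 : ℕ) : ℝ)) atTop atTop :=
    tendsto_natCast_atTop_atTop.comp (tendsto_add_atTop_nat 1)
  have h2 : Tendsto (fun N : ℕ => C * ((N + 1 : ℕ) : ℝ) ^ (-(1 / 3 : ℝ))) atTop (𝓝 (C * 0)) :=
    ((tendsto_rpow_neg_atTop (by norm_num : (0 : ℝ) < 1 / 3)).comp h1).const_mul C
  rw [mul_zero] at h2
  obtain ⟨N₀, hN₀⟩ := eventually_atTop.1 (h2.eventually_le_const hδ)
  exact ⟨N₀, hN₀⟩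

end NoWrap

open NoWrap in
/-- **No wrap-around: inside the kinetic window no particle travels a quarter of the torus** (registered stub
`stub_noWrap` of crux stmt-AtomisticToContinuum-14535, line `Sketch`). Under the global Gibbs law
`P = localGibbsLaw σ 1 0 θ₀ N Φ`, for `N ≥ N₀(θ₀, τ, δ)` and `w = τ (N+1)^{-1/3}`:
`P {z | ∃ k, 1/4 ≤ ∫⁻_{(0,w]} ‖v_k(Φ_t z)‖ dt} ≤ δ`. Union bound over the `N + 1` particles
(`measure_iUnion_fintype_le`) and the one-particle bound `8⁴ M₄ w⁴` (`NoWrap.measure_longPath_particle_le`); the total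
`(N+1) 8⁴ M₄ τ⁴ (N+1)^{-4/3} = 8⁴ M₄ τ⁴ (N+1)^{-1/3}` is `≤ δ` for large `N`. [folklore] -/
theorem stub_noWrap {θ₀ : ℝ} (hθ : 0 < θ₀) {σ : ℝ} (hσ : 0 < σ) (hσ2 : σ ≤ 2⁻¹) {τ : ℝ} (hτ : 0 < τ) {δ : ℝ}
    (hδ : 0 < δ) :
    ∃ N₀ : ℕ, ∀ N : ℕ, N₀ ≤ N → ∀ Φ : HardSphereFlow (Torus.geometry (Fin 3)) (hsDiameter σ N) (N + 1),
      localGibbsLaw σ (fun _ => 1) (fun _ => 0) (fun _ => θ₀) N Φ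
          {z | ∃ k : Fin (N + 1), ENNReal.ofReal (1 / 4) ≤
            ∫⁻ t in Set.Ioc 0 (τ * ((N + 1 : ℕ) : ℝ) ^ (-(1 / 3 : ℝ))), ENNReal.ofReal ‖(Φ.flow t z k).2‖} ≤
        ENNReal.ofReal δ := by
  have _hσ0 := hσ
  set M : ℝ := ∫ v, ‖v‖ ^ 4 ∂(gaussMeasure (0 : V3) θ₀) with hM
  obtain ⟨N₀, hN₀⟩ := exists_nat_mul_rpow_le (8 ^ 4 * M * τ ^ 4) hδ
  refine ⟨N₀, fun N hN Φ => ?_⟩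
  have hNb := hN₀ N hN
  set n : ℝ := ((N + 1 : ℕ) : ℝ) with hn
  have hn0 : 0 < n := by
    rw [hn]
    positivity
  set x : ℝ := n ^ (-(1 / 3 : ℝ)) with hx
  have hx0 : 0 < x := Real.rpow_pos_of_pos hn0 _
  have hx3 : n * x ^ 3 = 1 := by
    have h : x ^ 3 = n⁻¹ := by
      rw [hx, ← Real.rpow_natCast, ← Real.rpow_mul hn0.le,
        show (-(1 / 3 : ℝ)) * ((3 : ℕ) : ℝ) = -1 by norm_num, Real.rpow_neg_one]
    rw [h, mul_inv_cancel₀ hn0.ne']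
  have hw0 : 0 < τ * x := mul_pos hτ hx0
  -- union bound over the particles
  have hS : {z : Config (N + 1) (Fin 3) T3 | ∃ k : Fin (N + 1), ENNReal.ofReal (1 / 4) ≤
        ∫⁻ t in Set.Ioc 0 (τ * x), ENNReal.ofReal ‖(Φ.flow t z k).2‖} =
      ⋃ k : Fin (N + 1), {z | ENNReal.ofReal (1 / 4) ≤
        ∫⁻ t in Set.Ioc 0 (τ * x), ENNReal.ofReal ‖(Φ.flow t z k).2‖} := by
    ext z
    simp only [Set.mem_setOf_eq, Set.mem_iUnion]
  -- the real bookkeeping: `(N+1) · 8⁴ M (τ x)⁴ = 8⁴ M τ⁴ x` since `(N+1) x³ = 1`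
  have hnb : n * (8 ^ 4 * M * (τ * x) ^ 4) = 8 ^ 4 * M * τ ^ 4 * x := by
    calc n * (8 ^ 4 * M * (τ * x) ^ 4) = 8 ^ 4 * M * τ ^ 4 * x * (n * x ^ 3) := by ring
      _ = 8 ^ 4 * M * τ ^ 4 * x := by rw [hx3, mul_one]
  calc localGibbsLaw σ (fun _ => 1) (fun _ => 0) (fun _ => θ₀) N Φ
        {z | ∃ k : Fin (N + 1), ENNReal.ofReal (1 / 4) ≤
          ∫⁻ t in Set.Ioc 0 (τ * x), ENNReal.ofReal ‖(Φ.flow t z k).2‖}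
      = localGibbsLaw σ (fun _ => 1) (fun _ => 0) (fun _ => θ₀) N Φ
          (⋃ k : Fin (N + 1), {z | ENNReal.ofReal (1 / 4) ≤
            ∫⁻ t in Set.Ioc 0 (τ * x), ENNReal.ofReal ‖(Φ.flow t z k).2‖}) := by rw [hS]
    _ ≤ ∑ k : Fin (N + 1), localGibbsLaw σ (fun _ => 1) (fun _ => 0) (fun _ => θ₀) N Φ
          {z | ENNReal.ofReal (1 / 4) ≤ ∫⁻ t in Set.Ioc 0 (τ * x), ENNReal.ofReal ‖(Φ.flow t z k).2‖} :=
        measure_iUnion_fintype_le _ _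
    _ ≤ ∑ _k : Fin (N + 1), ENNReal.ofReal (8 ^ 4 * M * (τ * x) ^ 4) :=
        Finset.sum_le_sum fun k _ => measure_longPath_particle_le hθ hσ2 N Φ k hw0
    _ = ENNReal.ofReal (n * (8 ^ 4 * M * (τ * x) ^ 4)) := by
        rw [Finset.sum_const, Finset.card_univ, Fintype.card_fin, nsmul_eq_mul,
          ENNReal.ofReal_mul hn0.le, hn, ENNReal.ofReal_natCast]
    _ ≤ ENNReal.ofReal δ := by
        refine ENNReal.ofReal_le_ofReal ?_
        rw [hnb]
        exact hNb

end

end Summit.AtomisticToContinuum.HydrodynamicLimit.Theorems
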